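import Summits.BirchSwinnertonDyer.BirchSwinnertonDyer.Theorems.ClassRecordThreeCornerTwistWitnessUnitTwin
import HarnessLib

/-!
# Routes `ClassRecordThree` / `KolyvaginRoadThree` (rung K2@3), crux 7 `CornerAtThree` (item
# stmt-BirchSwinnertonDyer-19111) — the EXACT-TWIN ENGINE (all Tamagawa exponents): ONE odd Heegner twin with unit
# analytic Sha, plus — on the Tamagawa cells only — the analytic `μ = 0` certificate AT EXACT TWINS, IS a twist witness
# `CornerTwistWitnessAt W` (crux idea F, K3 + P2; cell `bsd-stepL`, seat `bsd-stepL-mult-p3` g4;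
# `--supports stmt-BirchSwinnertonDyer-19111 --as helper`)

Theorems only; no definition, no named fact, no `sorry`. NO new mathematics: bookkeeping on top of
`Theorems/ClassRecordThreeCornerTwistWitnessUnitTwin.lean` (the t0 unit-twin engine).

## What this file proves

For a (T4″)@3 corner pair `(E,3)` and an EXACT odd Heegner twin `Wd = Cd • E^{(d_K)}` (`d_K` odd, `d_K < -4`, Heegner
for `N_E` and `3`, `L(E^{d_K},1) ≠ 0`, and `#Ш_an(Wd) ∈ ℚ^×` a `3`-ADIC UNIT — crux F1 `ExactTwinSupplyAt` of card F):

* §1 `missingLowerBoundAt_of_shaAn_unit` — the main-conjecture half at `Wd` is FREE (`ord₃ #Ш_an = 0 ≤ ord₃ #Ш`; port of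
  the planner's sketch l. 81); `LOne_div_realPeriodRat_eq_of_shaAn` — in rank `0`, `L(Wd,1)/Ω(Wd) = #Ш_an·∏c/#tors²`, so
  `ord₃(L(Wd,1)/Ω(Wd)) = ord₃ #Ш_an + ord₃ ∏c(Wd) − 2·ord₃ #tors(Wd)`;
* §2 `bsdp_twin_of_muAn_of_shaAn_unit` — ANY Tamagawa exponent: certificate at `Wd` + unit `#Ш_an(Wd)` ⇒ `BSDp Wd 3`
  (K3's `bsdp_twin_of_muAn_of_lower` with §1); `bsdp_twin_of_shaAn_unit_of_not_dvd_tamagawaProduct` — on t0 an exact twin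
  IS a unit-value twin (`ord₃ ∏c(Wd) = ord₃ ∏c(E) = 0`, `3 ∤ #tors(Wd)`), so K3's `bsdp_twin_of_unit_value` applies with
  NO certificate;
* §3 **`cornerTwistWitnessAt_of_exactTwinSupply`** — `⟨ExactTwinSupplyAt-body VERBATIM (sketch l. 64), inline⟩ →
  ⟨3 ∣ ∏c(E) → the analytic μ = 0 certificate at every EXACT odd Heegner twin⟩ → (13 named facts) → CornerTwistWitnessAt W`:
  the composition the benefit-cut line (plan g37 RULING 33 ADDENDUM STEP 3 (ii): stubs `exactTwinSupply3`,
  `twinMuAnAtWitness3` «t ≥ 1 only») needs for its witness conjunct — on t0 the second hypothesis is never invoked.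

HONEST FRAMING: CONDITIONAL on the thirteen named published facts displayed and on the SUPPLIED exact twin (F1, beyond
print at `ℓ = 3 ∣ N`; per-pair certifiable) and, on the Tamagawa cells, on the supplied certificate (per-pair OMS
certificate or cards A∕E); nothing booked; item 19111 does NOT close; no census word, tier or label moves (T7); O2 stays
OPEN; BSD(E,3) is proved for no class by this file.

References: [Miller2011LMS] Def. 1.1; [MazurTateTeitelbaum1986] §I.8, §I.10; [Kato2004Asterisque] §17.13; [Wuthrich2014]
Cor. 18; [SteinWuthrich2013] Thm. 6.1; [GreenbergLNM1716] Thm. 1.5; [GrossKohnenZagier1987] (card F: exactness = minimal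
Heegner index); tree `…CornerTwistWitnessUnitTwin.lean`; cell board RULING 33 + ADDENDUM (2026-08-27).
-/

set_option autoImplicit false
-- the cell's Theorems namespace repeats the summit name (Summit.<Summit>.<Problem>), as in every sibling file
set_option linter.dupNamespace false

noncomputable section

open scoped Classical NumberField MatrixGroups ModularForm

namespace Summit.BirchSwinnertonDyer.BirchSwinnertonDyer.Theorems.CornerTwistWitness

open CongruenceSubgroup WeierstrassCurve NumberField IsDedekindDomain Field
  Literature.NumberTheory.EllipticCurves
  Literature.NumberTheory.EllipticCurves.ModularForms
  Literature.NumberTheory.EllipticCurves.Rank1Residual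
  Literature.NumberTheory.EllipticCurves.Rank1Residual.Typed
  Literature.NumberTheory.EllipticCurves.Wuthrich2014
  Literature.NumberTheory.EllipticCurves.SteinWuthrich2013
  Literature.NumberTheory.EllipticCurves.Greenberg1999
  Literature.NumberTheory.EllipticCurves.Kato2004
  Literature.NumberTheory.QuadraticFields.Quadratic
  Summit.BirchSwinnertonDyer.Rank1Residual
  Summit.BirchSwinnertonDyer.Rank1Residual.X11b
  Summit.BirchSwinnertonDyer.Rank1Residual.X11b.Three

/-! ### §1 Unit analytic Sha: the lower half is free; the value in terms of `#Ш_an` -/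

/-- **At a curve with unit analytic Sha the main-conjecture half `ord_p #Ш_an ≤ ord_p #Ш` is free** (`0 ≤ ord_p #Ш`).
Port of the planner's sketch `missingLowerBoundAt_three_of_shaAn_unit` at any prime. Bookkeeping.
-- adapted from Summits/BirchSwinnertonDyer/BirchSwinnertonDyer/Cruxes/CornerAtThree/IdeaOneDatumRecutUnitTwinSketch.lean (l. 81)
[cite: Miller2011LMS, §1 and Def. 1.1 (arXiv:1010.2431 p. 3)] -/
theorem missingLowerBoundAt_of_shaAn_unit (V : WeierstrassCurve ℚ) (p : ℕ)
    (h : ∃ q : ℚ, shaAn V = (q : ℂ) ∧ padicValRat p q = 0) : Typed.MissingLowerBoundAt V p := by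
  obtain ⟨q, hq, hv⟩ := h
  exact ⟨q, hq, by rw [hv]; exact_mod_cast Nat.zero_le _⟩

/-- **In analytic rank `0`, `L(E,1)/Ω(E) = #Ш_an·∏c/#tors²`** (Miller Def. 1.1 with `Reg = 1`, GZK `hGZK` for the rank).
Bookkeeping. [cite: Miller2011LMS, §1 and Def. 1.1 (arXiv:1010.2431 p. 3)] -/
theorem LOne_div_realPeriodRat_eq_of_shaAn (hGZK : rank_eq_analyticRank_of_analyticRank_le_one)
    (V : WeierstrassCurve ℚ) [V.IsElliptic] (hr : V.analyticRank = 0) {s : ℚ} (hs : shaAn V = (s : ℂ)) :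
    V.entireLFunction 1 / (V.realPeriodRat : ℂ) =
      ((s * (V.tamagawaProduct : ℚ) / (V.torsionOrder : ℚ) ^ 2 : ℚ) : ℂ) := by
  obtain ⟨hrank, _⟩ := hGZK V (by omega)
  have hmw : V.mordellWeilRank = 0 := by omega
  have hΩ : (V.realPeriodRat : ℂ) ≠ 0 := by exact_mod_cast V.realPeriodRat_pos_holds.ne'
  have hc : (V.tamagawaProduct : ℂ) ≠ 0 := by exact_mod_cast V.tamagawaProduct_pos_holds.ne'
  have ht : (V.torsionOrder : ℂ) ≠ 0 := by exact_mod_cast V.torsionOrder_pos_holds.ne'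
  have hL : V.leadingLCoeff = V.entireLFunction 1 := leadingLCoeff_eq_of_analyticRank_eq_zero V hr
  have h1 := hs
  rw [shaAn_def, hL, V.regulator_eq_one_of_rank_zero hmw, Complex.ofReal_one, mul_one,
    div_eq_iff (mul_ne_zero hΩ hc)] at h1
  -- `h1 : L(1) · #tors² = s · (Ω · ∏c)`
  rw [div_eq_iff hΩ]
  push_cast
  rw [div_mul_eq_mul_div, eq_div_iff (pow_ne_zero 2 ht), h1]
  ring

/-- **`ord_p(L(E,1)/Ω(E)) = ord_p #Ш_an + ord_p ∏c − 2·ord_p #tors` in analytic rank `0`** (for `#Ш_an ≠ 0`), with the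
value displayed as a rational. Bookkeeping. [cite: Miller2011LMS, §1 and Def. 1.1 (arXiv:1010.2431 p. 3)] -/
theorem exists_LOne_div_realPeriodRat_of_shaAn (hGZK : rank_eq_analyticRank_of_analyticRank_le_one)
    (V : WeierstrassCurve ℚ) [V.IsElliptic] (p : ℕ) [Fact p.Prime] (hr : V.analyticRank = 0) {s : ℚ}
    (hs0 : s ≠ 0) (hs : shaAn V = (s : ℂ)) :
    ∃ q : ℚ, q ≠ 0 ∧ V.entireLFunction 1 / (V.realPeriodRat : ℂ) = (q : ℂ) ∧
      padicValRat p q = padicValRat p s + padicValNat p V.tamagawaProduct - 2 * padicValNat p V.torsionOrder := by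
  have ht' : (V.torsionOrder : ℚ) ≠ 0 := by exact_mod_cast V.torsionOrder_pos_holds.ne'
  have hc' : (V.tamagawaProduct : ℚ) ≠ 0 := by exact_mod_cast V.tamagawaProduct_pos_holds.ne'
  refine ⟨s * (V.tamagawaProduct : ℚ) / (V.torsionOrder : ℚ) ^ 2,
    div_ne_zero (mul_ne_zero hs0 hc') (pow_ne_zero 2 ht'), LOne_div_realPeriodRat_eq_of_shaAn hGZK V hr hs, ?_⟩
  rw [padicValRat.div (mul_ne_zero hs0 hc') (pow_ne_zero 2 ht'), padicValRat.mul hs0 hc',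
    padicValRat.pow (V.torsionOrder : ℚ), padicValRat.of_nat, padicValRat.of_nat]
  ring

/-! ### §2 `BSD₃` of ONE exact odd Heegner twin -/

/-- **`BSD(Wd,3)` at ONE EXACT odd Heegner twin from the analytic certificate at `Wd` (any Tamagawa exponent)**: the lower
half is free (§1) and K3's `bsdp_twin_of_muAn_of_lower` concludes. CONDITIONAL on the thirteen named facts, on the exact
twin and on the certificate `hAn`; nothing booked. [cite: Kato2004Asterisque, §17.13 (pp. 279–280)]
[cite: Wuthrich2014, Cor. 18 (p. 398)] [cite: SteinWuthrich2013, Thm. 6.1 (p. 20)] [cite: Miller2011LMS, Def. 1.1] -/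
theorem bsdp_twin_of_muAn_of_shaAn_unit
    (hJs : thm61_splitMultiplicative) (hJn : thm61_nonsplitMultiplicative)
    (hGZK : rank_eq_analyticRank_of_analyticRank_le_one) (hmod : hasEntireLFunction_rat)
    (hpar : nonempty_modularParametrizationData)
    (hGS : ∀ (W : WeierstrassCurve ℚ) [W.IsElliptic] [W.IsGloballyMinimal] (p : ℕ) [Fact p.Prime],
      greenberg_stevens (W := W) (p := p))
    (hne : Kato2004.nonempty_iwasawaH1Data) (h12 : Kato2004.thm12_4)
    (hns : Kato2004.exists_multDivisibilityInputs_nonsplit)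
    (hsp : Kato2004.exists_multDivisibilityInputs_split)
    (h15 : thm15_isTorsion_multiplicative_rat)
    (h18 : Wuthrich2014.corollary18_padicLFunction_mem_iwasawaAlgebra_multiplicative)
    (hfine : Kato2004.exists_multDivisibilityInputs_fine)
    (W : WeierstrassCurve ℚ) [W.IsElliptic] [W.IsGloballyMinimal] (hX : ClassX11b W 3) (hnsj : ¬ Surj W 3)
    (K : Type) [Field K] [NumberField K] (Wd : WeierstrassCurve ℚ) [Wd.IsElliptic] [Wd.IsGloballyMinimal]
    (Cd : VariableChange ℚ) (hKq : IsImaginaryQuadratic K)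
    (hHN : SatisfiesHeegnerHypothesis (W.conductorNorm ℤ) K)
    (hLt : (W.quadraticTwist (NumberField.discr K : ℚ)).entireLFunction 1 ≠ 0)
    (hWd : Cd • W.quadraticTwist (NumberField.discr K : ℚ) = Wd)
    (hsha : ∃ q : ℚ, q ≠ 0 ∧ shaAn Wd = (q : ℂ) ∧ padicValRat 3 q = 0)
    (hAn : ∀ {N : ℕ} [NeZero N] (f : CuspForm (Gamma0 N) 2), IsNewformOf Wd f →
      ∀ (ϖ : ℚ), (ϖ : ℝ) * Wd.realPeriodRat = plusPeriod f →
      ∀ (a : ℚ_[3]) (L : PowerSeries ℚ_[3]),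
        (Wd.HasSplitMultiplicativeReductionAtPrime 3 → a = 1) →
        (¬ Wd.HasSplitMultiplicativeReductionAtPrime 3 → a = -1) →
        IsMultPAdicLFunctionOf f 3 a L →
        ∃ n : ℕ, ‖PowerSeries.coeff n (PowerSeries.C ((ϖ : ℚ) : ℚ_[3]) * L)‖ = 1) :
    BSDp Wd 3 := by
  obtain ⟨q, -, hq, hv⟩ := hsha
  exact bsdp_twin_of_muAn_of_lower hJs hJn hGZK hmod hpar hGS hne h12 hns hsp h15 h18 hfine W hX hnsj K Wd Cd hKq
    hHN hLt hWd (missingLowerBoundAt_of_shaAn_unit Wd 3 ⟨q, hq, hv⟩) hAn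

/-- **On t0 an EXACT twin is a UNIT-VALUE twin, so `BSD(Wd,3)` needs NO certificate**: `ord₃(L(Wd,1)/Ω(Wd)) =
ord₃ #Ш_an(Wd) + ord₃ ∏c(Wd) − 2·ord₃ #tors(Wd) = 0 + ord₃ ∏c(E) − 0 = 0` (Heegner transport of the Tamagawa exponent,
`Wd[3]` irreducible), then K3's `bsdp_twin_of_unit_value`. CONDITIONAL on the thirteen named facts and the exact twin;
nothing booked. [cite: MazurTateTeitelbaum1986, §I.10] [cite: Kato2004Asterisque, §17.13 (pp. 279–280)]
[cite: Wuthrich2014, Cor. 18 (p. 398)] [cite: SteinWuthrich2013, Thm. 6.1 (p. 20)] [cite: Miller2011LMS, Def. 1.1] -/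
theorem bsdp_twin_of_shaAn_unit_of_not_dvd_tamagawaProduct
    (hJs : thm61_splitMultiplicative) (hJn : thm61_nonsplitMultiplicative)
    (hGZK : rank_eq_analyticRank_of_analyticRank_le_one) (hmod : hasEntireLFunction_rat)
    (hpar : nonempty_modularParametrizationData)
    (hGS : ∀ (W : WeierstrassCurve ℚ) [W.IsElliptic] [W.IsGloballyMinimal] (p : ℕ) [Fact p.Prime],
      greenberg_stevens (W := W) (p := p))
    (hne : Kato2004.nonempty_iwasawaH1Data) (h12 : Kato2004.thm12_4)
    (hns : Kato2004.exists_multDivisibilityInputs_nonsplit)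
    (hsp : Kato2004.exists_multDivisibilityInputs_split)
    (h15 : thm15_isTorsion_multiplicative_rat)
    (h18 : Wuthrich2014.corollary18_padicLFunction_mem_iwasawaAlgebra_multiplicative)
    (hfine : Kato2004.exists_multDivisibilityInputs_fine)
    (W : WeierstrassCurve ℚ) [W.IsElliptic] [W.IsGloballyMinimal] (hX : ClassX11b W 3) (hnsj : ¬ Surj W 3)
    (ht0 : ¬ 3 ∣ W.tamagawaProduct)
    (K : Type) [Field K] [NumberField K] (Wd : WeierstrassCurve ℚ) [Wd.IsElliptic] [Wd.IsGloballyMinimal]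
    (Cd : VariableChange ℚ) (hKq : IsImaginaryQuadratic K) (hodd : Odd (NumberField.discr K))
    (hHN : SatisfiesHeegnerHypothesis (W.conductorNorm ℤ) K) (hH3 : SatisfiesHeegnerHypothesis 3 K)
    (hLt : (W.quadraticTwist (NumberField.discr K : ℚ)).entireLFunction 1 ≠ 0)
    (hWd : Cd • W.quadraticTwist (NumberField.discr K : ℚ) = Wd)
    (hsha : ∃ q : ℚ, q ≠ 0 ∧ shaAn Wd = (q : ℂ) ∧ padicValRat 3 q = 0) : BSDp Wd 3 := by
  haveI : Fact (Nat.Prime 3) := ⟨Nat.prime_three⟩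
  obtain ⟨s, hs0, hs, hvs⟩ := hsha
  have hD0 : (NumberField.discr K : ℚ) ≠ 0 := by exact_mod_cast NumberField.discr_ne_zero K
  haveI hEt : (W.quadraticTwist (NumberField.discr K : ℚ)).IsElliptic := W.isElliptic_quadraticTwist hD0
  have hp2 : (3 : ℕ) ≠ 2 := by decide
  have hLt' : (W.quadraticTwist (NumberField.discr K : ℚ)).entireLFunction = Wd.entireLFunction := by
    rw [← hWd, entireLFunction_smul]
  have hLd1 : Wd.entireLFunction 1 ≠ 0 := by rw [← hLt']; exact hLt
  have hrd : Wd.analyticRank = 0 := (Wd.analyticRank_eq_zero_iff_holds (hmod Wd)).2 hLd1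
  have hirrd : Wd.HasIrreducibleModPGaloisRep 3 :=
    hasIrreducibleModPGaloisRep_twist_model W 3 K hKq.1 hX.2.2.2 Cd hWd
  have hpd : ¬ (3 : ℤ) ∣ NumberField.discr K := not_dvd_discr_of_split hKq Nat.prime_three hp2 hH3
  have htam : padicValNat 3 Wd.tamagawaProduct = 0 := by
    rw [X2.padicValNat_tamagawaProduct_twist_of_heegner_of_odd W 3 hp2 K hKq hodd hpd hHN Cd hWd]
    exact padicValNat.eq_zero_of_not_dvd ht0
  have htors : padicValNat 3 Wd.torsionOrder = 0 := padicValNat_torsionOrder_eq_zero_of_irreducible Wd 3 hirrd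
  obtain ⟨q, hq0, hq, hvq⟩ := exists_LOne_div_realPeriodRat_of_shaAn hGZK Wd 3 hrd hs0 hs
  rw [hvs, htam, htors] at hvq
  norm_num at hvq
  exact bsdp_twin_of_unit_value hJs hJn hGZK hmod hpar hGS hne h12 hns hsp h15 h18 hfine W hX hnsj ht0 K Wd Cd hKq
    hodd hHN hH3 hLt hWd hq0 hq hvq

/-! ### §3 The engine: an exact odd Heegner twin (+ the certificate at exact twins on the Tamagawa cells) IS a witness -/

/-- **THE EXACT-TWIN ENGINE (card F, K3 + P2): an EXACT odd Heegner twin IS a `CornerTwistWitnessAt` witness — on t0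
outright, on the Tamagawa cells `3 ∣ ∏c(E)` given the analytic `μ = 0` certificate at exact twins.** Hypothesis `hexact`
is VERBATIM the body of the planner's sketch predicate `ExactTwinSupplyAt W` (`Cruxes/CornerAtThree/IdeaOneDatumRecutUnitTwinSketch.lean`
l. 64, stated INLINE): SOME imaginary quadratic `K` (`d_K` odd, `d_K < -4`, Heegner for `N_E` and `3`, `L(E^{d_K},1) ≠ 0`)
and a global minimal twist model `Wd` with `#Ш_an(Wd)` a non-zero rational `3`-adic unit. Hypothesis `hAnT` = the
analytic certificate (unit coefficient of `ϖ·L_3(f)`, both signs) at every such EXACT twin, asked ONLY when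
`3 ∣ ∏c(E)` («t ≥ 1 only»). Conclusion `CornerTwistWitnessAt W`: t0 by `bsdp_twin_of_shaAn_unit_of_not_dvd_tamagawaProduct`,
carriers by `bsdp_twin_of_muAn_of_shaAn_unit`. The composition the benefit-cut line's stubs `exactTwinSupply3` +
`twinMuAnAtWitness3` feed (plan g37 RULING 33 ADDENDUM STEP 3 (ii)). CONDITIONAL on the thirteen named facts and the two
supplies; nothing booked; item 19111 does NOT close. [cite: MazurTateTeitelbaum1986, §I.10]
[cite: Kato2004Asterisque, §17.13 (pp. 279–280)] [cite: Wuthrich2014, Cor. 18 (p. 398)] [cite: SteinWuthrich2013, Thm. 6.1 (p. 20)]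
[cite: GreenbergLNM1716, Thm. 1.5 (PDF p. 61)] [cite: Miller2011LMS, Def. 1.1] -/
theorem cornerTwistWitnessAt_of_exactTwinSupply
    (hJs : thm61_splitMultiplicative) (hJn : thm61_nonsplitMultiplicative)
    (hGZK : rank_eq_analyticRank_of_analyticRank_le_one) (hmod : hasEntireLFunction_rat)
    (hpar : nonempty_modularParametrizationData)
    (hGS : ∀ (W : WeierstrassCurve ℚ) [W.IsElliptic] [W.IsGloballyMinimal] (p : ℕ) [Fact p.Prime],
      greenberg_stevens (W := W) (p := p))
    (hne : Kato2004.nonempty_iwasawaH1Data) (h12 : Kato2004.thm12_4)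
    (hns : Kato2004.exists_multDivisibilityInputs_nonsplit)
    (hsp : Kato2004.exists_multDivisibilityInputs_split)
    (h15 : thm15_isTorsion_multiplicative_rat)
    (h18 : Wuthrich2014.corollary18_padicLFunction_mem_iwasawaAlgebra_multiplicative)
    (hfine : Kato2004.exists_multDivisibilityInputs_fine)
    (W : WeierstrassCurve ℚ) [W.IsElliptic] [W.IsGloballyMinimal]
    -- F1 (exact-twin supply, the body of `ExactTwinSupplyAt W` verbatim)
    (hexact : ClassX11b W 3 → ¬ Surj W 3 →
      ∃ (K : Type) (_ : Field K) (_ : NumberField K)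
        (Wd : WeierstrassCurve ℚ) (_ : Wd.IsElliptic) (_ : Wd.IsGloballyMinimal) (Cd : VariableChange ℚ),
        IsImaginaryQuadratic K ∧ Odd (NumberField.discr K) ∧ NumberField.discr K < -4 ∧
          SatisfiesHeegnerHypothesis (W.conductorNorm ℤ) K ∧ SatisfiesHeegnerHypothesis 3 K ∧
          (W.quadraticTwist (NumberField.discr K : ℚ)).entireLFunction 1 ≠ 0 ∧
          Cd • W.quadraticTwist (NumberField.discr K : ℚ) = Wd ∧
          ∃ q : ℚ, q ≠ 0 ∧ shaAn Wd = (q : ℂ) ∧ padicValRat 3 q = 0)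
    -- the analytic μ = 0 certificate at EXACT odd Heegner twins, on the Tamagawa cells only («t ≥ 1»)
    (hAnT : 3 ∣ W.tamagawaProduct → ∀ (K : Type) [Field K] [NumberField K]
      (Wd : WeierstrassCurve ℚ) [Wd.IsElliptic] [Wd.IsGloballyMinimal] (Cd : VariableChange ℚ),
      ClassX11b W 3 → ¬ Surj W 3 → IsImaginaryQuadratic K → Odd (NumberField.discr K) →
      SatisfiesHeegnerHypothesis (W.conductorNorm ℤ) K →
      (W.quadraticTwist (NumberField.discr K : ℚ)).entireLFunction 1 ≠ 0 →
      Cd • W.quadraticTwist (NumberField.discr K : ℚ) = Wd →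
      (∃ q : ℚ, q ≠ 0 ∧ shaAn Wd = (q : ℂ) ∧ padicValRat 3 q = 0) →
      ∀ {N : ℕ} [NeZero N] (f : CuspForm (Gamma0 N) 2), IsNewformOf Wd f →
      ∀ (ϖ : ℚ), (ϖ : ℝ) * Wd.realPeriodRat = plusPeriod f →
      ∀ (a : ℚ_[3]) (L : PowerSeries ℚ_[3]),
        (Wd.HasSplitMultiplicativeReductionAtPrime 3 → a = 1) →
        (¬ Wd.HasSplitMultiplicativeReductionAtPrime 3 → a = -1) →
        IsMultPAdicLFunctionOf f 3 a L →
        ∃ n : ℕ, ‖PowerSeries.coeff n (PowerSeries.C ((ϖ : ℚ) : ℚ_[3]) * L)‖ = 1) :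
    CornerTwistWitnessAt W := by
  intro hX hnsj
  obtain ⟨K, _, _, Wd, _, _, Cd, hKq, hodd, hlt, hHN, hH3, hLt, hWd, hsha⟩ := hexact hX hnsj
  refine ⟨K, inferInstance, inferInstance, Wd, inferInstance, inferInstance, Cd, hKq, hodd, hlt, hHN, hH3, hLt, hWd, ?_⟩
  by_cases ht : 3 ∣ W.tamagawaProduct
  · exact bsdp_twin_of_muAn_of_shaAn_unit hJs hJn hGZK hmod hpar hGS hne h12 hns hsp h15 h18 hfine W hX hnsj K Wd Cd
      hKq hHN hLt hWd hsha
      (fun f hf ϖ hϖ a L hsa hna hL ↦ hAnT ht K Wd Cd hX hnsj hKq hodd hHN hLt hWd hsha f hf ϖ hϖ a L hsa hna hL)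
  · exact bsdp_twin_of_shaAn_unit_of_not_dvd_tamagawaProduct hJs hJn hGZK hmod hpar hGS hne h12 hns hsp h15 h18 hfine
      W hX hnsj ht K Wd Cd hKq hodd hHN hH3 hLt hWd hsha

end Summit.BirchSwinnertonDyer.BirchSwinnertonDyer.Theorems.CornerTwistWitness

end
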